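import Mathlib
import Summits.Langlands.Langlands.Theorems.IrreducibilityBySelfDualityHeckeEigenvalueFieldStubEndScalarSmooth
import Summits.Langlands.Langlands.Theorems.IrreducibilityBySelfDualityHeckeEigenvalueFieldStubConeGrowthCoeff
import Literature.NumberTheory.Automorphic.ResGLnArchEntryBounds
import HarnessLib

/-!
# Polynomial growth of the lift of a family of cone forms and of its derivative —
crux `HeckeEigenvalueField` (stmt-Langlands-13632), line `Sketch`, stub END-SCALAR, part GROWTH

Namespace `Summit.Langlands.Langlands.Theorems.HeckeEigenvalueField.Res`.  Theorems only; the
operator-norm topology on `M_n(K_∞)` (ResConeAnalytic preamble), as in part SMOOTH and in the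
registered statement of END-SCALAR.

For the lift `u(Y)(g, c) = E(g)⁻¹ β_c(g gᴴ)(tg_g Y₁, …, tg_g Y_q)` of a family `β_c` with GLOBAL
polynomial `C¹` bounds on the positive cone (the conclusion of the registered GLOBAL-GROWTH):
`stub_endScalar_lift_growth` — for every level coset `c` there are `A, r` with
`‖u(Y)(g, c')‖ ≤ A (1 ⊔ H_∞(g))^r` and `‖d/dt|₀ u(Y)(g e^{tX}, c')‖ ≤ A (1 ⊔ H_∞(g))^r` for all `g ∈ G_∞`
and all `c'` in the coset (`H_∞` the archimedean height `GLn.archHeight` of `(g, 1)`): the entries of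
`g^{±1}` are `≤ H_∞(g)` (`ResGLnCone.norm_entry_le_archHeight`, Literature `ResGLnArchEntryBounds`), the coefficient representation grows polynomially
(`stub_coneGrowth_coeffRep`), the entry gauge of `g gᴴ` and the tangent vectors `tg_g Y = g (Y + Yᴴ) gᴴ`
are quadratic in the entries (`entryGauge_hermSquare_le`, `hermSpace_norm_conj_le`), the derivative is
the explicit Leibniz expression of part SMOOTH (`endScalar_hasDerivAt_lift`), and `dE(X)` is a bounded
operator of the finite-dimensional `E_λ(ℂ)`.
References: A. Borel, N. Wallach (2000), VII 2.2 [BorelWallach2000]; A. Borel, *Regularization theorems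
in Lie algebra cohomology*, Duke Math. J. 50 (1983), §3.5 [Borel1983Regularization]; A. Borel,
H. Jacquet, Corvallis (1979), §1.2 [BorelJacquetCorvallis1979].
-/

set_option linter.dupNamespace false -- project-wide: `Summit.Langlands.Langlands` is the mandated namespace

noncomputable section

open scoped Classical Matrix Matrix.Norms.Operator Topology TensorProduct ContDiff NNReal
open Filter NumberField NumberField.mixedEmbedding Literature.NumberTheory.Automorphic
open Literature.NumberTheory.Automorphic.RealMatrixGroup

-- ResConeAnalytic preamble: ONE topology on `M_n(K_∞)` (the operator norm), as in part SMOOTH.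
attribute [-instance] instTopologicalSpaceMatrix
attribute [-instance] Matrix.instUniformSpace
attribute [local instance high] NormedAddCommGroup.toSeminormedAddCommGroup

namespace Summit.Langlands.Langlands.Theorems.HeckeEigenvalueField.Res

set_option maxHeartbeats 1600000 in
-- the datum-typed statement (abstract `sq`, `tg`, `u`) and a long chain of explicit estimates
/-- **Stub END-SCALAR, part GROWTH — the lift and its derivative along `g e^{tX}` are polynomially
bounded in the archimedean height, coset by coset.**  For the lift
`u(Y)(g, c) = E(g)⁻¹ β_c(g gᴴ)(tg_g Y₁, …, tg_g Y_q)` of a family with GLOBAL polynomial `C¹` bounds on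
the cone (the conclusion of GLOBAL-GROWTH) one has, for every level coset `c`, constants `A, r` with
`‖u(Y)(g, c')‖, ‖d/dt|₀ u(Y)(g e^{tX}, c')‖ ≤ A (1 ⊔ H_∞(g))^r` for all `g ∈ G_∞` and all `c'` in `c`:
coefficient growth of `E(g)⁻¹` (`stub_coneGrowth_coeffRep`), the entry gauge of `g gᴴ` and the tangent
vectors `tg_g Y = g (Y + Yᴴ) gᴴ` are quadratic in the entries of `g^{±1} ≤ H_∞(g)`, the explicit
derivative `endScalar_hasDerivAt_lift`, and `dE(X)` is bounded. [cite: BorelWallach2000, VII 2.2]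
[cite: Borel1983Regularization, §3.5] -/
theorem stub_endScalar_lift_growth {n : ℕ} {K : Type} [Field K] [NumberField K]
    (hcpt : isCompact_glFiniteIntegralLevel n K) (𝔫 : Ideal (𝓞 K))
    (S : Finset {w : InfinitePlace K // w.IsReal}) (lam : (K →+* ℂ) → Fin n → ℤ) {q : ℕ}
    (sq : (AutomorphyDatum.gl n K hcpt).arch.carrier → ResGLnCone.hermSpace n K)
    (hsq : ∀ h : (AutomorphyDatum.gl n K hcpt).arch.carrier,
      (sq h : Matrix (Fin n) (Fin n) (mixedSpace K)) =
        ((h : GL (Fin n) (mixedSpace K)) : Matrix (Fin n) (Fin n) (mixedSpace K)) *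
          (((h : GL (Fin n) (mixedSpace K)) : Matrix (Fin n) (Fin n) (mixedSpace K)))ᴴ)
    (tg : (AutomorphyDatum.gl n K hcpt).arch.carrier → (AutomorphyDatum.gl n K hcpt).arch.lie →
      ResGLnCone.hermSpace n K)
    (htg : ∀ (h : (AutomorphyDatum.gl n K hcpt).arch.carrier) (Y : (AutomorphyDatum.gl n K hcpt).arch.lie),
      (tg h Y : Matrix (Fin n) (Fin n) (mixedSpace K)) =
        ((h : GL (Fin n) (mixedSpace K)) : Matrix (Fin n) (Fin n) (mixedSpace K)) *
            (Y : Matrix (Fin n) (Fin n) (mixedSpace K)) *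
            (((h : GL (Fin n) (mixedSpace K)) : Matrix (Fin n) (Fin n) (mixedSpace K)))ᴴ +
          ((h : GL (Fin n) (mixedSpace K)) : Matrix (Fin n) (Fin n) (mixedSpace K)) *
            (Y : Matrix (Fin n) (Fin n) (mixedSpace K))ᴴ *
            (((h : GL (Fin n) (mixedSpace K)) : Matrix (Fin n) (Fin n) (mixedSpace K)))ᴴ)
    (β : (BigHeckeGLn.FiniteAdelicGL n K ⧸ ResGLnCohomology.level n K 𝔫) →
      ResGLnCone.hermSpace n K → ResGLnCone.hermSpace n K [⋀^Fin q]→L[ℝ] ResGLnCohomology.CoeffModule ℂ n K lam)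
    (hβs : ∀ c, ContDiffOn ℝ ((⊤ : ℕ∞) : WithTop ℕ∞) (β c) (ResGLnCone.posCone n K))
    (hglob : ∀ c : BigHeckeGLn.FiniteAdelicGL n K ⧸ ResGLnCohomology.level n K 𝔫, ∃ (C : ℝ) (k : ℕ),
      ∀ H ∈ ResGLnCone.posCone n K, ∀ (v : Fin q → ResGLnCone.hermSpace n K) (w' : ResGLnCone.hermSpace n K),
        ‖β c H v‖ ≤ C * (1 + ∑ i, ∑ j,
              (‖(H : Matrix (Fin n) (Fin n) (mixedSpace K)) i j‖ +
                ‖(H : Matrix (Fin n) (Fin n) (mixedSpace K))⁻¹ i j‖)) ^ k * ∏ i, ‖v i‖ ∧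
        ‖fderiv ℝ (β c) H w' v‖ ≤ C * (1 + ∑ i, ∑ j,
              (‖(H : Matrix (Fin n) (Fin n) (mixedSpace K)) i j‖ +
                ‖(H : Matrix (Fin n) (Fin n) (mixedSpace K))⁻¹ i j‖)) ^ k * ‖w'‖ * ∏ i, ‖v i‖)
    (u : (Fin q → (AutomorphyDatum.gl n K hcpt).arch.lie) → (AutomorphyDatum.gl n K hcpt).arch.carrier →
      BigHeckeGLn.FiniteAdelicGL n K → ResGLnCohomology.CoeffModule ℂ n K lam)
    (hu : ∀ Yt g c, u Yt g c = ConeDictionary.σS hcpt S lam g⁻¹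
      (β (c : BigHeckeGLn.FiniteAdelicGL n K ⧸ ResGLnCohomology.level n K 𝔫) (sq g) (fun i => tg g (Yt i))))
    (Yt : Fin q → (AutomorphyDatum.gl n K hcpt).arch.lie) (X : (AutomorphyDatum.gl n K hcpt).arch.lie)
    (c : BigHeckeGLn.FiniteAdelicGL n K ⧸ ResGLnCohomology.level n K 𝔫) :
    ∃ (A : ℝ) (r : ℕ), ∀ (g : (AutomorphyDatum.gl n K hcpt).arch.carrier) (c' : BigHeckeGLn.FiniteAdelicGL n K),
      (c' : BigHeckeGLn.FiniteAdelicGL n K ⧸ ResGLnCohomology.level n K 𝔫) = c →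
      ‖u Yt g c'‖ ≤ A * (1 ⊔ (GLn.archHeight n K ((AutomorphyDatum.gl n K hcpt).ofArch g) : ℝ)) ^ r ∧
      ‖deriv (fun t : ℝ => u Yt (g * (AutomorphyDatum.gl n K hcpt).arch.expMem (t • X)) c') 0‖ ≤
        A * (1 ⊔ (GLn.archHeight n K ((AutomorphyDatum.gl n K hcpt).ofArch g) : ℝ)) ^ r := by
  -- the size function and the coefficient growth
  set sz : (AutomorphyDatum.gl n K hcpt).arch.carrier → ℝ :=
    fun g => 1 ⊔ (GLn.archHeight n K ((AutomorphyDatum.gl n K hcpt).ofArch g) : ℝ) with hsz_def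
  have hsz1 : ∀ g, 1 ≤ sz g := fun g => le_sup_left
  have hsz0 : ∀ g, 0 ≤ sz g := fun g => zero_le_one.trans (hsz1 g)
  have hE : ∀ (g : (AutomorphyDatum.gl n K hcpt).arch.carrier) i j,
      ‖((g : GL (Fin n) (mixedSpace K)) : Matrix (Fin n) (Fin n) (mixedSpace K)) i j‖ ≤ sz g :=
    fun g i j => (ResGLnCone.norm_entry_le_archHeight hcpt g i j).1.trans le_sup_right
  have hI : ∀ (g : (AutomorphyDatum.gl n K hcpt).arch.carrier) i j,
      ‖(((g⁻¹ : (AutomorphyDatum.gl n K hcpt).arch.carrier) : GL (Fin n) (mixedSpace K)) :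
        Matrix (Fin n) (Fin n) (mixedSpace K)) i j‖ ≤ sz g :=
    fun g i j => (ResGLnCone.norm_entry_le_archHeight hcpt g i j).2.trans le_sup_right
  obtain ⟨Cσ, kσ, hCσ0, hσ⟩ := stub_coneGrowth_coeffRep n K sz hsz1 hE hI S lam
  have hszi : ∀ g, sz g⁻¹ = sz g := fun g => by
    simp only [hsz_def, ResGLnCone.archHeight_ofArch_inv]
  -- the global bounds on the coset `c`, with a non-negative constant
  obtain ⟨C, k, hCk⟩ := hglob c
  set C' : ℝ := max C 0 with hC'
  have hC'0 : 0 ≤ C' := le_max_right _ _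
  -- the fixed matrices and the common constant for the tangent vectors
  set cZ : Matrix (Fin n) (Fin n) (mixedSpace K) → ℝ := fun Z => ∑ l, ∑ m, ‖Z l m‖ with hcZ
  have hcZ0 : ∀ Z, 0 ≤ cZ Z := fun Z => Finset.sum_nonneg fun _ _ => Finset.sum_nonneg fun _ _ => norm_nonneg _
  set ZX : Matrix (Fin n) (Fin n) (mixedSpace K) := X.1 + X.1ᴴ with hZX
  set Zt : Fin q → Matrix (Fin n) (Fin n) (mixedSpace K) := fun i => (Yt i).1 + (Yt i).1ᴴ with hZt
  set ZW : Fin q → Matrix (Fin n) (Fin n) (mixedSpace K) :=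
    fun j => X.1 * (Yt j).1 + (Yt j).1 * X.1ᴴ + X.1 * (Yt j).1ᴴ + (Yt j).1ᴴ * X.1ᴴ with hZW
  set cmax : ℝ := cZ ZX + ∑ i, (cZ (Zt i) + cZ (ZW i)) with hcmax
  have hsumnn : 0 ≤ ∑ i, (cZ (Zt i) + cZ (ZW i)) :=
    Finset.sum_nonneg fun i _ => add_nonneg (hcZ0 _) (hcZ0 _)
  have hcmax0 : 0 ≤ cmax := add_nonneg (hcZ0 _) hsumnn
  have hZX_le : cZ ZX ≤ cmax := le_add_of_nonneg_right hsumnn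
  have hZt_le : ∀ i, cZ (Zt i) ≤ cmax := fun i =>
    ((le_add_of_nonneg_right (hcZ0 (ZW i))).trans
      (Finset.single_le_sum (f := fun i => cZ (Zt i) + cZ (ZW i))
        (fun i _ => add_nonneg (hcZ0 _) (hcZ0 _)) (Finset.mem_univ i))).trans
      (le_add_of_nonneg_left (hcZ0 _))
  have hZW_le : ∀ i, cZ (ZW i) ≤ cmax := fun i =>
    ((le_add_of_nonneg_left (hcZ0 (Zt i))).trans
      (Finset.single_le_sum (f := fun i => cZ (Zt i) + cZ (ZW i))
        (fun i _ => add_nonneg (hcZ0 _) (hcZ0 _)) (Finset.mem_univ i))).trans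
      (le_add_of_nonneg_left (hcZ0 _))
  -- the tangent vectors are quadratic
  have htgb : ∀ (g : (AutomorphyDatum.gl n K hcpt).arch.carrier) (Y : (AutomorphyDatum.gl n K hcpt).arch.lie),
      ‖tg g Y‖ ≤ cZ (Y.1 + Y.1ᴴ) * sz g ^ 2 := fun g Y =>
    ResGLnCone.hermSpace_norm_conj_le (tg g Y) (by rw [htg, Matrix.mul_add, Matrix.add_mul]) (hsz0 g) (hE g)
  have hWmem : ∀ (g : (AutomorphyDatum.gl n K hcpt).arch.carrier) (j : Fin q),
      g.1.1 * ZW j * g.1.1ᴴ ∈ ResGLnCone.hermSpace n K := by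
    intro g j
    rw [ResGLnCone.mem_hermSpace_iff]
    simp only [hZW, Matrix.conjTranspose_mul, Matrix.conjTranspose_add, Matrix.conjTranspose_conjTranspose,
      Matrix.mul_add, Matrix.add_mul, Matrix.mul_assoc]
    abel
  have hWb : ∀ (g : (AutomorphyDatum.gl n K hcpt).arch.carrier) (j : Fin q),
      ‖(⟨g.1.1 * ZW j * g.1.1ᴴ, hWmem g j⟩ : ResGLnCone.hermSpace n K)‖ ≤ cZ (ZW j) * sz g ^ 2 := fun g j =>
    ResGLnCone.hermSpace_norm_conj_le _ rfl (hsz0 g) (hE g)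
  -- the entry gauge of `sq g`
  have hEg : ∀ g : (AutomorphyDatum.gl n K hcpt).arch.carrier,
      (1 + ∑ i, ∑ j, (‖(sq g : Matrix (Fin n) (Fin n) (mixedSpace K)) i j‖ +
        ‖(sq g : Matrix (Fin n) (Fin n) (mixedSpace K))⁻¹ i j‖)) ≤ (1 + 2 * (n : ℝ) ^ 3) * sz g ^ 2 := by
    intro g
    rw [hsq]
    exact ResGLnCone.entryGauge_hermSquare_le (g : GL (Fin n) (mixedSpace K)) (hsz1 g) (hE g) (hI g)
  have hEg0 : ∀ g : (AutomorphyDatum.gl n K hcpt).arch.carrier,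
      0 ≤ (1 + ∑ i, ∑ j, (‖(sq g : Matrix (Fin n) (Fin n) (mixedSpace K)) i j‖ +
        ‖(sq g : Matrix (Fin n) (Fin n) (mixedSpace K))⁻¹ i j‖)) := fun g =>
    zero_le_one.trans (le_add_of_nonneg_right (Finset.sum_nonneg fun _ _ => Finset.sum_nonneg fun _ _ =>
      add_nonneg (norm_nonneg _) (norm_nonneg _)))
  set cE : ℝ := 1 + 2 * (n : ℝ) ^ 3 with hcE
  have hcE0 : 0 ≤ cE := add_nonneg zero_le_one (mul_nonneg zero_le_two (pow_nonneg (Nat.cast_nonneg n) 3))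
  -- the operator bound of `dE(X)`
  set Mσ : ℝ := ‖LinearMap.toContinuousLinearMap (ConeDictionary.σ𝔤S hcpt lam X)‖ with hMσ
  have hMσ0 : 0 ≤ Mσ := norm_nonneg _
  have hdE : ∀ e, ‖ConeDictionary.σ𝔤S hcpt lam X e‖ ≤ Mσ * ‖e‖ := fun e =>
    (LinearMap.toContinuousLinearMap (ConeDictionary.σ𝔤S hcpt lam X)).le_opNorm e
  -- the constants
  set P : ℕ := kσ + 2 * k + 2 * q with hP
  set A₁ : ℝ := Cσ * (C' * cE ^ k * cmax ^ q) with hA₁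
  have hK0 : 0 ≤ C' * cE ^ k * cmax ^ q := mul_nonneg (mul_nonneg hC'0 (pow_nonneg hcE0 _)) (pow_nonneg hcmax0 _)
  have hA₁0 : 0 ≤ A₁ := mul_nonneg hCσ0 hK0
  set A₂ : ℝ := Cσ * (C' * cE ^ k * cmax ^ (q + 1) + q * (C' * cE ^ k * cmax ^ q)) + Mσ * A₁ with hA₂
  have hK1 : 0 ≤ C' * cE ^ k * cmax ^ (q + 1) := mul_nonneg (mul_nonneg hC'0 (pow_nonneg hcE0 _)) (pow_nonneg hcmax0 _)
  have hK2 : 0 ≤ Cσ * ((q : ℝ) * (C' * cE ^ k * cmax ^ q)) + Mσ * A₁ :=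
    add_nonneg (mul_nonneg hCσ0 (mul_nonneg (Nat.cast_nonneg q) hK0)) (mul_nonneg hMσ0 hA₁0)
  have hA₂0 : 0 ≤ A₂ :=
    add_nonneg (mul_nonneg hCσ0 (add_nonneg hK1 (mul_nonneg (Nat.cast_nonneg q) hK0))) (mul_nonneg hMσ0 hA₁0)
  refine ⟨A₁ + A₂, P + 2, fun g c' hc' => ?_⟩
  subst hc'
  have hs1 := hsz1 g
  have hs0 := hsz0 g
  set s : ℝ := sz g with hs_def
  -- β-bounds at `sq g`
  have hCk' := hCk (sq g) (sq_mem_posCone hcpt sq hsq g)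
  have hb1 : ∀ v : Fin q → ResGLnCone.hermSpace n K,
      ‖β (c' : BigHeckeGLn.FiniteAdelicGL n K ⧸ ResGLnCohomology.level n K 𝔫) (sq g) v‖ ≤
        C * (1 + ∑ i, ∑ j, (‖(sq g : Matrix (Fin n) (Fin n) (mixedSpace K)) i j‖ +
          ‖(sq g : Matrix (Fin n) (Fin n) (mixedSpace K))⁻¹ i j‖)) ^ k * ∏ i, ‖v i‖ :=
    fun v => (hCk' v (tg g X)).1
  have hb2 : ∀ v : Fin q → ResGLnCone.hermSpace n K,
      ‖fderiv ℝ (β (c' : BigHeckeGLn.FiniteAdelicGL n K ⧸ ResGLnCohomology.level n K 𝔫)) (sq g) (tg g X) v‖ ≤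
        C * (1 + ∑ i, ∑ j, (‖(sq g : Matrix (Fin n) (Fin n) (mixedSpace K)) i j‖ +
          ‖(sq g : Matrix (Fin n) (Fin n) (mixedSpace K))⁻¹ i j‖)) ^ k * ‖tg g X‖ * ∏ i, ‖v i‖ :=
    fun v => (hCk' v (tg g X)).2
  have hgk : (1 + ∑ i, ∑ j, (‖(sq g : Matrix (Fin n) (Fin n) (mixedSpace K)) i j‖ +
      ‖(sq g : Matrix (Fin n) (Fin n) (mixedSpace K))⁻¹ i j‖)) ^ k ≤ cE ^ k * s ^ (2 * k) := by
    rw [pow_mul, ← mul_pow]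
    exact pow_le_pow_left₀ (hEg0 g) (hEg g) k
  -- the tuples of tangent vectors and their products
  have htY : ∀ i, ‖tg g (Yt i)‖ ≤ cmax * s ^ 2 := fun i =>
    (htgb g (Yt i)).trans (mul_le_mul_of_nonneg_right (hZt_le i) (sq_nonneg _))
  have htX : ‖tg g X‖ ≤ cmax * s ^ 2 := (htgb g X).trans (mul_le_mul_of_nonneg_right hZX_le (sq_nonneg _))
  have hprodY : ∏ i, ‖tg g (Yt i)‖ ≤ cmax ^ q * s ^ (2 * q) := by
    rw [pow_mul, ← mul_pow]; exact ResGLnCone.prod_norm_le_pow _ htY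
  -- (1) the value
  have hval : ‖u Yt g c'‖ ≤ A₁ * s ^ P := by
    rw [hu]
    have h1 : ‖ConeDictionary.σS hcpt S lam g⁻¹ (β (c' : BigHeckeGLn.FiniteAdelicGL n K ⧸
        ResGLnCohomology.level n K 𝔫) (sq g) (fun i => tg g (Yt i)))‖ ≤
        Cσ * s ^ kσ * ‖β (c' : BigHeckeGLn.FiniteAdelicGL n K ⧸ ResGLnCohomology.level n K 𝔫) (sq g)
          (fun i => tg g (Yt i))‖ := by
      have h := hσ g⁻¹ (β (c' : BigHeckeGLn.FiniteAdelicGL n K ⧸ ResGLnCohomology.level n K 𝔫) (sq g)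
        (fun i => tg g (Yt i)))
      have e : sz g⁻¹ = s := hszi g
      calc _ ≤ Cσ * sz g⁻¹ ^ kσ * ‖β (c' : BigHeckeGLn.FiniteAdelicGL n K ⧸ ResGLnCohomology.level n K 𝔫)
            (sq g) (fun i => tg g (Yt i))‖ := h
        _ = _ := by rw [e]
    have h2 : ‖β (c' : BigHeckeGLn.FiniteAdelicGL n K ⧸ ResGLnCohomology.level n K 𝔫) (sq g)
        (fun i => tg g (Yt i))‖ ≤ C' * (cE ^ k * s ^ (2 * k)) * (cmax ^ q * s ^ (2 * q)) := by
      refine (hb1 _).trans ?_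
      refine mul_le_mul (mul_le_mul (le_max_left _ _) hgk (pow_nonneg (hEg0 g) _) hC'0) hprodY
        (Finset.prod_nonneg fun i _ => norm_nonneg _)
        (mul_nonneg hC'0 (mul_nonneg (pow_nonneg hcE0 _) (pow_nonneg hs0 _)))
    calc _ ≤ Cσ * s ^ kσ * ‖β (c' : BigHeckeGLn.FiniteAdelicGL n K ⧸ ResGLnCohomology.level n K 𝔫) (sq g)
          (fun i => tg g (Yt i))‖ := h1
      _ ≤ Cσ * s ^ kσ * (C' * (cE ^ k * s ^ (2 * k)) * (cmax ^ q * s ^ (2 * q))) :=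
          mul_le_mul_of_nonneg_left h2 (mul_nonneg hCσ0 (pow_nonneg hs0 _))
      _ = A₁ * s ^ P := by rw [hA₁, hP, pow_add, pow_add]; ring
  refine ⟨hval.trans ((ResGLnCone.mul_pow_le_mul_pow_of_le hs1 hA₁0 (Nat.le_add_right P 2)).trans
    (mul_le_mul_of_nonneg_right (le_add_of_nonneg_right hA₂0) (pow_nonneg hs0 _))), ?_⟩
  -- (2) the derivative
  have hβd : DifferentiableAt ℝ (β (c' : BigHeckeGLn.FiniteAdelicGL n K ⧸ ResGLnCohomology.level n K 𝔫)) (sq g) :=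
    ((hβs _).contDiffAt ((ResGLnCone.isOpen_posCone n K).mem_nhds (sq_mem_posCone hcpt sq hsq g))).differentiableAt
      (by simp)
  set W : Fin q → ResGLnCone.hermSpace n K := fun j => ⟨g.1.1 * ZW j * g.1.1ᴴ, hWmem g j⟩ with hW_def
  have hWeq : ∀ j, (W j : Matrix (Fin n) (Fin n) (mixedSpace K)) =
      g.1.1 * X.1 * (Yt j).1 * g.1.1ᴴ + g.1.1 * (Yt j).1 * X.1ᴴ * g.1.1ᴴ + g.1.1 * X.1 * (Yt j).1ᴴ * g.1.1ᴴ +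
        g.1.1 * (Yt j).1ᴴ * X.1ᴴ * g.1.1ᴴ := by
    intro j
    simp only [hW_def, hZW, Matrix.mul_add, Matrix.add_mul, Matrix.mul_assoc]
  have hD := (endScalar_hasDerivAt_lift hcpt 𝔫 S lam sq hsq tg htg β u hu Yt g c' X hβd W hWeq).deriv
  rw [hD]
  have hWn : ∀ j, ‖W j‖ ≤ cmax * s ^ 2 := fun j =>
    (hWb g j).trans (mul_le_mul_of_nonneg_right (hZW_le j) (sq_nonneg _))
  have hupd : ∀ j, ∏ i, ‖Function.update (fun j => tg g (Yt j)) j (W j) i‖ ≤ cmax ^ q * s ^ (2 * q) := by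
    intro j
    rw [pow_mul, ← mul_pow]
    refine ResGLnCone.prod_norm_le_pow _ fun i => ?_
    by_cases hij : i = j
    · subst hij; rw [Function.update_self]; exact hWn i
    · rw [Function.update_of_ne hij]; exact htY i
  -- the form part
  have hform : ‖fderiv ℝ (β (c' : BigHeckeGLn.FiniteAdelicGL n K ⧸ ResGLnCohomology.level n K 𝔫)) (sq g) (tg g X)
        (fun j => tg g (Yt j)) +
      ∑ j, β (c' : BigHeckeGLn.FiniteAdelicGL n K ⧸ ResGLnCohomology.level n K 𝔫) (sq g)
        (Function.update (fun j => tg g (Yt j)) j (W j))‖ ≤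
      C' * (cE ^ k * s ^ (2 * k)) * (cmax * s ^ 2) * (cmax ^ q * s ^ (2 * q)) +
        q * (C' * (cE ^ k * s ^ (2 * k)) * (cmax ^ q * s ^ (2 * q))) := by
    refine (norm_add_le _ _).trans (add_le_add ?_ ?_)
    · refine (hb2 _).trans ?_
      refine mul_le_mul (mul_le_mul (mul_le_mul (le_max_left _ _) hgk (pow_nonneg (hEg0 g) _) hC'0) htX
        (norm_nonneg _) (mul_nonneg hC'0 (mul_nonneg (pow_nonneg hcE0 _) (pow_nonneg hs0 _)))) hprodY
        (Finset.prod_nonneg fun i _ => norm_nonneg _)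
        (mul_nonneg (mul_nonneg hC'0 (mul_nonneg (pow_nonneg hcE0 _) (pow_nonneg hs0 _)))
          (mul_nonneg hcmax0 (pow_nonneg hs0 _)))
    · refine (norm_sum_le _ _).trans ?_
      calc ∑ j, ‖β (c' : BigHeckeGLn.FiniteAdelicGL n K ⧸ ResGLnCohomology.level n K 𝔫) (sq g)
              (Function.update (fun j => tg g (Yt j)) j (W j))‖
          ≤ ∑ _j : Fin q, C' * (cE ^ k * s ^ (2 * k)) * (cmax ^ q * s ^ (2 * q)) :=
            Finset.sum_le_sum fun j _ => (hb1 _).trans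
              (mul_le_mul (mul_le_mul (le_max_left _ _) hgk (pow_nonneg (hEg0 g) _) hC'0) (hupd j)
                (Finset.prod_nonneg fun i _ => norm_nonneg _)
                (mul_nonneg hC'0 (mul_nonneg (pow_nonneg hcE0 _) (pow_nonneg hs0 _))))
        _ = q * (C' * (cE ^ k * s ^ (2 * k)) * (cmax ^ q * s ^ (2 * q))) := by
            rw [Finset.sum_const, Finset.card_univ, Fintype.card_fin, nsmul_eq_mul]
  have h1 : ‖ConeDictionary.σS hcpt S lam g⁻¹ (fderiv ℝ (β (c' : BigHeckeGLn.FiniteAdelicGL n K ⧸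
        ResGLnCohomology.level n K 𝔫)) (sq g) (tg g X) (fun j => tg g (Yt j)) +
      ∑ j, β (c' : BigHeckeGLn.FiniteAdelicGL n K ⧸ ResGLnCohomology.level n K 𝔫) (sq g)
        (Function.update (fun j => tg g (Yt j)) j (W j)))‖ ≤
      Cσ * s ^ kσ * ‖fderiv ℝ (β (c' : BigHeckeGLn.FiniteAdelicGL n K ⧸ ResGLnCohomology.level n K 𝔫)) (sq g)
        (tg g X) (fun j => tg g (Yt j)) +
      ∑ j, β (c' : BigHeckeGLn.FiniteAdelicGL n K ⧸ ResGLnCohomology.level n K 𝔫) (sq g)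
        (Function.update (fun j => tg g (Yt j)) j (W j))‖ := by
    have h := hσ g⁻¹ (fderiv ℝ (β (c' : BigHeckeGLn.FiniteAdelicGL n K ⧸ ResGLnCohomology.level n K 𝔫)) (sq g)
        (tg g X) (fun j => tg g (Yt j)) +
      ∑ j, β (c' : BigHeckeGLn.FiniteAdelicGL n K ⧸ ResGLnCohomology.level n K 𝔫) (sq g)
        (Function.update (fun j => tg g (Yt j)) j (W j)))
    have e : sz g⁻¹ = s := hszi g
    calc _ ≤ Cσ * sz g⁻¹ ^ kσ * _ := h
      _ = _ := by rw [e]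
  have h2 := hdE (u Yt g c')
  calc _ ≤ ‖ConeDictionary.σS hcpt S lam g⁻¹ (fderiv ℝ (β (c' : BigHeckeGLn.FiniteAdelicGL n K ⧸
            ResGLnCohomology.level n K 𝔫)) (sq g) (tg g X) (fun j => tg g (Yt j)) +
          ∑ j, β (c' : BigHeckeGLn.FiniteAdelicGL n K ⧸ ResGLnCohomology.level n K 𝔫) (sq g)
            (Function.update (fun j => tg g (Yt j)) j (W j)))‖ +
        ‖ConeDictionary.σ𝔤S hcpt lam X (u Yt g c')‖ := norm_sub_le _ _
    _ ≤ Cσ * s ^ kσ * (C' * (cE ^ k * s ^ (2 * k)) * (cmax * s ^ 2) * (cmax ^ q * s ^ (2 * q)) +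
          q * (C' * (cE ^ k * s ^ (2 * k)) * (cmax ^ q * s ^ (2 * q)))) + Mσ * (A₁ * s ^ P) :=
        add_le_add (h1.trans (mul_le_mul_of_nonneg_left hform (mul_nonneg hCσ0 (pow_nonneg hs0 _))))
          (h2.trans (mul_le_mul_of_nonneg_left hval hMσ0))
    _ = Cσ * (C' * cE ^ k * cmax ^ (q + 1)) * s ^ (P + 2) +
          (Cσ * (q * (C' * cE ^ k * cmax ^ q)) + Mσ * A₁) * s ^ P := by
        rw [hA₁, hP]; ring
    _ ≤ Cσ * (C' * cE ^ k * cmax ^ (q + 1)) * s ^ (P + 2) +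
          (Cσ * (q * (C' * cE ^ k * cmax ^ q)) + Mσ * A₁) * s ^ (P + 2) :=
        add_le_add le_rfl (ResGLnCone.mul_pow_le_mul_pow_of_le hs1 hK2 (Nat.le_add_right P 2))
    _ = A₂ * s ^ (P + 2) := by rw [hA₂, hA₁]; ring
    _ ≤ (A₁ + A₂) * s ^ (P + 2) :=
        mul_le_mul_of_nonneg_right (le_add_of_nonneg_left hA₁0) (pow_nonneg hs0 _)

end Summit.Langlands.Langlands.Theorems.HeckeEigenvalueField.Res

end
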